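import Literature.AnabelianGeometry.SemiGraphs.PSCRamificationProofs
import HarnessLib

/-!
# PSC data of smooth-proper shape (one vertex, no edges, `Π_v = Π`): [CombGC] Prop. 1.2, Prop. 1.5, Thm. 1.6 hold

Mochizuki, *A combinatorial version of the Grothendieck conjecture*, Tohoku Math. J. **59** (2007)
[CombGC] §1 pp. 6–14 [cite: MochizukiCombGC2007, §1 pp.6-14].  A datum `G : PSCDatum Π`
(`PSCFundamentalGroup.lean`, abc-iut-L3-t4) has the SHAPE that Def. 1.1 extracts from a SMOOTH PROPER
curve (a pointed stable curve with one irreducible component, no nodes, no cusps; `Π_G = Π_v`) iff its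
semi-graph has one vertex and no edges and `Π_v = Π` (hypotheses `IsEmpty G.graph.N`,
`IsEmpty G.graph.C`, `∀ v, G.vertGp v = ⊤`, `∀ w, w = v₀` below).  PROOF-ONLY file (no
`def`/`structure`/`instance`; the frozen interface is untouched): for EVERY such datum over EVERY
topological group the predicates typed in `PSCGraphicity.lean` for Prop. 1.2 (i)(ii), Prop. 1.5 (i)(ii)
and Thm. 1.6 (i)(ii)(iii) HOLD — the verticial subgroups are `Π` (`isVerticial_iff_eq_top_of_vertGp_eq_top`),
there are no edge-like subgroups, `M^vert_{G_U} = M_{G_U}` and `M^edge_{G_U} = 0`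
(`vertFil_eq_of_vertGp_eq_top`; `M^edge = 0` as in `PSCNodeExistenceTransferProofs.edgeFil_eq_of_isEmpty`), every `α : Π_G ≅ Π_H` between two such data is
graphic (`isGraphic_of_smoothProper`) and graphically filtration-preserving, every `β : Π^unr_G ≅ Π^unr_H`
is verticially filtration-preserving and group-theoretically verticial.  These are the data-level
lemmas behind the instance forms of the abc-iut FACT-LIST rows F-0438/0440/0443/0444/0458/0459/0461 at
origins of smooth-proper-shaped data (companion `PSCSmoothProperOrigin.lean`).  A shape check of the
typing (consistency evidence at the simplest geometric shape), not the printed theorems; nothing here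
takes a side on [IUTchIII] Cor. 3.12.
-/

noncomputable section

namespace Literature.AnabelianGeometry.SemiGraphs

namespace PSCDatum

open scoped Pointwise

universe u

variable {P : Type u} [Group P] [TopologicalSpace P] [IsTopologicalGroup P]
variable {P' : Type u} [Group P'] [TopologicalSpace P'] [IsTopologicalGroup P']

/-! ### Data of smooth-proper shape: one vertex, no edges, `Π_v = Π` -/

section Shape

variable (G : PSCDatum P)

omit [IsTopologicalGroup P] in
/-- With `Π_v = Π` for every vertex (and a vertex present), the verticial subgroups are exactly `⊤`.
[cite: MochizukiCombGC2007, Def 1.1(ii) p.6] -/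
theorem isVerticial_iff_eq_top_of_vertGp_eq_top (hV : ∀ v, G.vertGp v = ⊤) (v₀ : G.graph.V)
    (A : Subgroup P) : G.IsVerticial A ↔ A = ⊤ := by
  refine ⟨?_, fun h => ⟨v₀, 1, by rw [h, hV, one_smul]⟩⟩
  rintro ⟨v, γ, rfl⟩
  rw [hV, conjAct_smul_top]

omit [IsTopologicalGroup P] in
/-- No nodes ⇒ no nodal subgroups. [cite: MochizukiCombGC2007, Def 1.1(ii) p.7] -/
theorem not_isNodal_of_isEmpty [hN : IsEmpty G.graph.N] (A : Subgroup P) : ¬ G.IsNodal A := by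
  rintro ⟨e, -, -⟩; exact hN.false e

omit [IsTopologicalGroup P] in
/-- No cusps ⇒ no cuspidal subgroups. [cite: MochizukiCombGC2007, Def 1.1(ii) p.7] -/
theorem not_isCuspidal_of_isEmpty [hC : IsEmpty G.graph.C] (A : Subgroup P) : ¬ G.IsCuspidal A := by
  rintro ⟨c, -, -⟩; exact hC.false c

omit [IsTopologicalGroup P] in
/-- No edges ⇒ no edge-like subgroups. [cite: MochizukiCombGC2007, Def 1.1(ii) pp.6-7] -/
theorem not_isEdgeLike_of_isEmpty [IsEmpty G.graph.N] [IsEmpty G.graph.C] (A : Subgroup P) :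
    ¬ G.IsEdgeLike A := fun h =>
  h.elim (G.not_isNodal_of_isEmpty A) (G.not_isCuspidal_of_isEmpty A)

/-- No edges ⇒ `Ker(Π ↠ Π^unr) = closure {1}`. [cite: MochizukiCombGC2007, Def 1.1(ii) p.7] -/
theorem unrKer_eq_closure_bot_of_isEmpty [IsEmpty G.graph.N] [IsEmpty G.graph.C] :
    G.unrKer = (⊥ : Subgroup P).topologicalClosure := by
  unfold unrKer
  congr 1
  rw [Set.iUnion_of_empty, Set.iUnion_of_empty, Set.union_empty, Subgroup.normalClosure_empty]

/-- No edges ⇒ `M^edge_{G_U}` is trivial: `edgeFil U = closure [U, U]` (a private copy of the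
lemma of `PSCNodeExistenceTransferProofs.lean`, to keep this file's imports light).
[cite: MochizukiCombGC2007, Def 1.1(ii) p.7] -/
private theorem edgeFil_eq_closure_commutator [IsEmpty G.graph.N] [IsEmpty G.graph.C] (U : Subgroup P) :
    G.edgeFil U = (⁅U, U⁆ : Subgroup P).topologicalClosure := by
  haveI : IsEmpty {A : Subgroup P // G.IsEdgeLikeIn U A} :=
    ⟨fun A => by obtain ⟨B, hB, -⟩ := A.2; exact G.not_isEdgeLike_of_isEmpty B hB⟩
  unfold edgeFil
  rw [iSup_of_empty, sup_bot_eq]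

omit [TopologicalSpace P] [IsTopologicalGroup P] in
/-- `[U, U] ≤ U`. [folklore] -/
private theorem commutator_le_self (U : Subgroup P) : ⁅U, U⁆ ≤ U :=
  Subgroup.commutator_le.mpr fun _ ha _ hb =>
    U.mul_mem (U.mul_mem (U.mul_mem ha hb) (U.inv_mem ha)) (U.inv_mem hb)

/-- With `Π_v = Π`: `vertFil U = closure U` (`M^vert_{G_U} = M_{G_U}`).
[cite: MochizukiCombGC2007, Def 1.1(ii) p.7] -/
theorem vertFil_eq_of_vertGp_eq_top (hV : ∀ v, G.vertGp v = ⊤) (v₀ : G.graph.V) (U : Subgroup P) :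
    G.vertFil U = U.topologicalClosure := by
  have hsup : (⨆ A : {A : Subgroup P // G.IsVerticialIn U A}, (A : Subgroup P)) = U := by
    refine le_antisymm (iSup_le fun A => ?_) ?_
    · obtain ⟨B, -, hA⟩ := A.2
      rw [hA]; exact inf_le_left
    · have hU : G.IsVerticialIn U U :=
        ⟨⊤, (G.isVerticial_iff_eq_top_of_vertGp_eq_top hV v₀ ⊤).mpr rfl, by rw [inf_top_eq]⟩
      exact le_iSup (fun A : {A : Subgroup P // G.IsVerticialIn U A} => (A : Subgroup P)) ⟨U, hU⟩
  unfold vertFil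
  rw [hsup, sup_eq_right.mpr (commutator_le_self U)]

/-- For an OPEN subgroup (closed), `vertFil U = U`. [cite: MochizukiCombGC2007, Def 1.1(ii) p.7] -/
theorem vertFil_eq_self_of_isOpen (hV : ∀ v, G.vertGp v = ⊤) (v₀ : G.graph.V) {U : Subgroup P}
    (hU : IsOpen (U : Set P)) : G.vertFil U = U := by
  rw [G.vertFil_eq_of_vertGp_eq_top hV v₀]
  exact le_antisymm (Subgroup.topologicalClosure_minimal U le_rfl (U.isClosed_of_isOpen hU))
    (Subgroup.le_topologicalClosure U)

omit [IsTopologicalGroup P] in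
/-- No cusps ⇒ every covering has `r = 0`. [cite: MochizukiCombGC2007, Def 1.1(i) p.6] -/
theorem cuspCount_eq_zero_of_isEmpty [IsEmpty G.graph.C] (U : Subgroup P) : G.cuspCount U = 0 := by
  unfold cuspCount
  exact Finset.sum_eq_zero fun c _ => isEmptyElim c

end Shape

/-! ### Transport of closures and commutators along `α : Π ≃ Π'` -/

/-- A topological isomorphism carries topological closures to topological closures. [folklore] -/
private theorem map_topologicalClosure_equiv (α : P ≃ₜ* P') (S : Subgroup P) :
    (S.topologicalClosure).map α.toMulEquiv.toMonoidHom = (S.map α.toMulEquiv.toMonoidHom).topologicalClosure := by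
  apply SetLike.coe_injective
  rw [Subgroup.coe_map, Subgroup.topologicalClosure_coe, Subgroup.topologicalClosure_coe,
    Subgroup.coe_map]
  exact (α.toHomeomorph.image_closure (S : Set P))

/-! ### Prop. 1.2, Prop. 1.5, Thm. 1.6 (i)(ii) at the smooth-proper shape -/

section Positive

variable (G : PSCDatum P) (H : PSCDatum P')

omit [IsTopologicalGroup P] in
/-- **Prop. 1.2 (i), verticial**, at one vertex. [cite: MochizukiCombGC2007, Prop 1.2(i) p.8] -/
theorem verticialOpenInterDeterminesVertex_of_subsingleton (v₀ : G.graph.V) (hv : ∀ w, w = v₀) :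
    G.VerticialOpenInterDeterminesVertex := fun v₁ v₂ _ _ _ => by rw [hv v₁, hv v₂]

omit [IsTopologicalGroup P] in
/-- **Prop. 1.2 (i), edge-like**, with no edges (vacuous). [cite: MochizukiCombGC2007, Prop 1.2(i) p.8] -/
theorem edgeLikeOpenInterDeterminesEdge_of_isEmpty [IsEmpty G.graph.N] [IsEmpty G.graph.C] :
    G.EdgeLikeOpenInterDeterminesEdge := fun e₁ => isEmptyElim e₁

/-- **Prop. 1.2 (i), unramified**, at one vertex. [cite: MochizukiCombGC2007, Prop 1.2(i) p.8] -/
theorem unrVerticialOpenInterDeterminesVertex_of_subsingleton (v₀ : G.graph.V) (hv : ∀ w, w = v₀) :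
    G.UnrVerticialOpenInterDeterminesVertex := fun _ v₁ v₂ _ _ _ => by rw [hv v₁, hv v₂]

omit [TopologicalSpace P] [IsTopologicalGroup P] in
/-- `C_Π(Π) = Π`. [folklore] -/
private theorem commensurator_top' : Subgroup.Commensurable.commensurator (⊤ : Subgroup P) = ⊤ :=
  eq_top_iff.mpr fun g _ => by
    rw [Subgroup.Commensurable.commensurator_mem_iff, conjAct_smul_top]

/-- **Prop. 1.2 (ii)** at the smooth-proper shape: the verticial subgroups are `Π` (commensurably
terminal), there are no edge-like ones, and `Π_v · Ker = Π`. [cite: MochizukiCombGC2007, Prop 1.2(ii) p.8] -/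
theorem commensurablyTerminal_of_smoothProper [IsEmpty G.graph.N] [IsEmpty G.graph.C]
    (hV : ∀ v, G.vertGp v = ⊤) (v₀ : G.graph.V) :
    G.VerticialEdgeLikeCommensurablyTerminal ∧ G.UnrVerticialCommensurablyTerminal := by
  refine ⟨fun A hA => ?_, fun _ B hB => ?_⟩
  · rcases hA with hA | hA
    · rw [(G.isVerticial_iff_eq_top_of_vertGp_eq_top hV v₀ A).mp hA]; exact commensurator_top'
    · exact absurd hA (G.not_isEdgeLike_of_isEmpty A)
  · obtain ⟨A, hA, rfl⟩ := hB
    rw [(G.isVerticial_iff_eq_top_of_vertGp_eq_top hV v₀ A).mp hA, top_sup_eq]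
    exact commensurator_top'

omit [IsTopologicalGroup P] in
/-- **Prop. 1.5 (i)** with no edges (vacuous). [cite: MochizukiCombGC2007, Prop 1.5(i) p.12] -/
theorem edgeLikeIncidence_of_isEmpty [IsEmpty G.graph.N] [IsEmpty G.graph.C] : G.EdgeLikeIncidence :=
  fun E hE => absurd hE (G.not_isEdgeLike_of_isEmpty E)

omit [IsTopologicalGroup P] [IsTopologicalGroup P'] in
/-- Two one-vertex edgeless semi-graphs are isomorphic. [cite: MochizukiSemiAnbd2006, §1 p.11] -/
theorem nonempty_iso_of_smoothProper [IsEmpty G.graph.N] [IsEmpty G.graph.C] [IsEmpty H.graph.N]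
    [IsEmpty H.graph.C] (v₀ : G.graph.V) (hv : ∀ w, w = v₀) (w₀ : H.graph.V) (hw : ∀ w, w = w₀) :
    Nonempty (PSCSemiGraph.Iso G.graph H.graph) :=
  ⟨{ vertEquiv := ⟨fun _ => w₀, fun _ => v₀, fun v => (hv v).symm, fun w => (hw w).symm⟩
     nodeEquiv := Equiv.equivOfIsEmpty _ _
     cuspEquiv := Equiv.equivOfIsEmpty _ _
     nodeEnds_comm := fun e => isEmptyElim e
     cuspEnd_comm := fun c => isEmptyElim c }⟩

omit [IsTopologicalGroup P] [IsTopologicalGroup P'] in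
/-- At the smooth-proper shape EVERY `α : Π_G ≅ Π_H` is graphic (one vertex ↦ one vertex,
`α(Π) = Π'`). [cite: MochizukiCombGC2007, Def 1.4(i) p.10] -/
theorem isGraphic_of_smoothProper [IsEmpty G.graph.N] [IsEmpty G.graph.C] [IsEmpty H.graph.N]
    [IsEmpty H.graph.C] (hV : ∀ v, G.vertGp v = ⊤) (v₀ : G.graph.V) (hv : ∀ w, w = v₀)
    (hW : ∀ w, H.vertGp w = ⊤) (w₀ : H.graph.V) (hw : ∀ w, w = w₀) (α : P ≃ₜ* P') :
    G.IsGraphic H α := by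
  obtain ⟨ι⟩ := G.nonempty_iso_of_smoothProper H v₀ hv w₀ hw
  refine ⟨ι, fun v => ⟨1, ?_⟩, fun e => isEmptyElim e, fun c => isEmptyElim c⟩
  rw [hV, hW, one_smul, Subgroup.map_top_of_surjective _ α.surjective]

omit [IsTopologicalGroup P] [IsTopologicalGroup P'] in
/-- At the smooth-proper shape every `α` is group-theoretically edge-like (vacuously) and verticial.
[cite: MochizukiCombGC2007, Def 1.4(iv) p.11] -/
theorem isGroupTheoreticallyEdgeLike_verticial_of_smoothProper [IsEmpty G.graph.N] [IsEmpty G.graph.C]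
    [IsEmpty H.graph.N] [IsEmpty H.graph.C] (hV : ∀ v, G.vertGp v = ⊤) (v₀ : G.graph.V)
    (hW : ∀ w, H.vertGp w = ⊤) (w₀ : H.graph.V) (α : P ≃ₜ* P') :
    G.IsGroupTheoreticallyEdgeLike H α ∧ G.IsGroupTheoreticallyVerticial H α := by
  refine ⟨⟨fun A hA => absurd hA (G.not_isEdgeLike_of_isEmpty A),
    fun B hB => absurd hB (H.not_isEdgeLike_of_isEmpty B)⟩, fun A hA => ?_, fun B hB => ⟨⊤, ?_, ?_⟩⟩
  · rw [(G.isVerticial_iff_eq_top_of_vertGp_eq_top hV v₀ A).mp hA,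
      Subgroup.map_top_of_surjective _ α.surjective]
    exact (H.isVerticial_iff_eq_top_of_vertGp_eq_top hW w₀ ⊤).mpr rfl
  · exact (G.isVerticial_iff_eq_top_of_vertGp_eq_top hV v₀ ⊤).mpr rfl
  · rw [Subgroup.map_top_of_surjective _ α.surjective,
      ← (H.isVerticial_iff_eq_top_of_vertGp_eq_top hW w₀ B).mp hB]

omit [IsTopologicalGroup P] [IsTopologicalGroup P'] in
/-- **Prop. 1.5 (ii)** at the smooth-proper shape (both sides hold; the semi-graph isomorphism is
unique). [cite: MochizukiCombGC2007, Prop 1.5(ii) p.13] -/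
theorem graphicIffEdgeLikeVerticial_of_smoothProper [IsEmpty G.graph.N] [IsEmpty G.graph.C]
    [IsEmpty H.graph.N] [IsEmpty H.graph.C] (hV : ∀ v, G.vertGp v = ⊤) (v₀ : G.graph.V)
    (hv : ∀ w, w = v₀) (hW : ∀ w, H.vertGp w = ⊤) (w₀ : H.graph.V) (hw : ∀ w, w = w₀)
    (α : P ≃ₜ* P') : G.GraphicIffEdgeLikeVerticial H α := by
  refine ⟨⟨fun _ => G.isGroupTheoreticallyEdgeLike_verticial_of_smoothProper H hV v₀ hW w₀ α,
    fun _ => G.isGraphic_of_smoothProper H hV v₀ hv hW w₀ hw α⟩, fun ι ι' _ _ => ⟨?_, ?_, ?_⟩⟩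
  · exact Equiv.ext fun v => by rw [hw (ι.vertEquiv v), hw (ι'.vertEquiv v)]
  · exact Equiv.ext fun e => isEmptyElim e
  · exact Equiv.ext fun c => isEmptyElim c

omit [IsTopologicalGroup P] [IsTopologicalGroup P'] in
/-- **Thm. 1.6 (i)** at the smooth-proper shape: both sides hold (`r = 0` everywhere; no cuspidal
subgroups). [cite: MochizukiCombGC2007, Thm 1.6(i) p.13] -/
theorem numericallyCuspidalIff_of_isEmpty [IsEmpty G.graph.C] [IsEmpty H.graph.C] (α : P ≃ₜ* P') :
    G.NumericallyCuspidalIffGroupTheoreticallyCuspidal H α :=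
  ⟨fun _ => ⟨fun A hA => absurd hA (G.not_isCuspidal_of_isEmpty A),
      fun B hB => absurd hB (H.not_isCuspidal_of_isEmpty B)⟩,
    fun _ U _ => by rw [G.cuspCount_eq_zero_of_isEmpty, H.cuspCount_eq_zero_of_isEmpty]⟩

/-- **Thm. 1.6 (ii)** at the smooth-proper shape: every `α` is graphic AND graphically
filtration-preserving (`M^vert = M`, `M^edge = 0` on both sides, preserved by any topological
isomorphism). [cite: MochizukiCombGC2007, Thm 1.6(ii) p.13] -/
theorem graphicIffGraphicallyFiltrationPreserving_of_smoothProper [IsEmpty G.graph.N]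
    [IsEmpty G.graph.C] [IsEmpty H.graph.N] [IsEmpty H.graph.C] (hV : ∀ v, G.vertGp v = ⊤)
    (v₀ : G.graph.V) (hv : ∀ w, w = v₀) (hW : ∀ w, H.vertGp w = ⊤) (w₀ : H.graph.V)
    (hw : ∀ w, w = w₀) (α : P ≃ₜ* P') : G.GraphicIffGraphicallyFiltrationPreserving H α := by
  refine ⟨fun _ => ⟨fun U _ => ?_, fun U _ => ?_⟩, fun _ => G.isGraphic_of_smoothProper H hV v₀ hv hW w₀ hw α⟩
  · rw [G.vertFil_eq_of_vertGp_eq_top hV v₀, H.vertFil_eq_of_vertGp_eq_top hW w₀,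
      map_topologicalClosure_equiv]
  · rw [G.edgeFil_eq_closure_commutator, H.edgeFil_eq_closure_commutator, map_topologicalClosure_equiv,
      Subgroup.map_commutator]

end Positive

/-! ### Thm. 1.6 (iii) at the smooth-proper shape -/

section Unr

variable (G : PSCDatum P) (H : PSCDatum P')

/-- `β` transports `Π` to `Π'` (private copy of the lemma of
`PSCVerticialRamificationTransportProofs.lean`). [cite: MochizukiCombGC2007, Def 1.4 p.10] -/
private theorem unrTransport_top_eq (β : (P ⧸ G.unrKer) ≃ₜ* (P' ⧸ H.unrKer)) : G.unrTransport H β ⊤ = ⊤ := by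
  unfold unrTransport
  rw [Subgroup.map_top_of_surjective _ (QuotientGroup.mk'_surjective _),
    Subgroup.map_top_of_surjective _ β.surjective, Subgroup.comap_top]

/-- `β` transports open subgroups to open subgroups (`Π ↠ Π^unr` is an open map; private copy of
the lemma of `PSCUnrVerticialLevelwiseProofs.lean`). [cite: MochizukiCombGC2007, Def 1.4 p.10] -/
private theorem isOpen_coe_unrTransport (β : (P ⧸ G.unrKer) ≃ₜ* (P' ⧸ H.unrKer)) {U : Subgroup P}
    (hU : IsOpen (U : Set P)) : IsOpen (G.unrTransport H β U : Set P') := by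
  unfold unrTransport
  rw [Subgroup.coe_comap, Subgroup.coe_map, Subgroup.coe_map]
  refine IsOpen.preimage (QuotientGroup.continuous_mk (N := H.unrKer)) ?_
  exact β.toHomeomorph.isOpenMap _ (QuotientGroup.isOpenMap_coe _ hU)

/-- With `Π_v = Π`: the unramified verticial subgroups are exactly `Π`.
[cite: MochizukiCombGC2007, Def 1.1(ii) p.7] -/
theorem isUnrVerticial_iff_eq_top_of_vertGp_eq_top (hV : ∀ v, G.vertGp v = ⊤) (v₀ : G.graph.V)
    (B : Subgroup P) : G.IsUnrVerticial B ↔ B = ⊤ := by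
  refine ⟨?_, fun h => ⟨⊤, (G.isVerticial_iff_eq_top_of_vertGp_eq_top hV v₀ ⊤).mpr rfl, ?_⟩⟩
  · rintro ⟨A, hA, rfl⟩
    rw [(G.isVerticial_iff_eq_top_of_vertGp_eq_top hV v₀ A).mp hA, top_sup_eq]
  · rw [h, top_sup_eq]

/-- **Thm. 1.6 (iii)** at the smooth-proper shape: every `β : Π^unr_G ≅ Π^unr_H` is both verticially
filtration-preserving and group-theoretically verticial. [cite: MochizukiCombGC2007, Thm 1.6(iii) p.13] -/
theorem unrVerticiallyFiltrationPreservingIffVerticial_of_smoothProper (hV : ∀ v, G.vertGp v = ⊤)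
    (v₀ : G.graph.V) (hW : ∀ w, H.vertGp w = ⊤) (w₀ : H.graph.V)
    (β : (P ⧸ G.unrKer) ≃ₜ* (P' ⧸ H.unrKer)) :
    G.UnrVerticiallyFiltrationPreservingIffVerticial H β := by
  refine fun _ _ => ⟨fun _ => ⟨fun B hB => ?_, fun B' hB' => ⟨⊤, ?_, ?_⟩⟩, fun _ U hU _ => ?_⟩
  · rw [(G.isUnrVerticial_iff_eq_top_of_vertGp_eq_top hV v₀ B).mp hB, unrTransport_top_eq]
    exact (H.isUnrVerticial_iff_eq_top_of_vertGp_eq_top hW w₀ ⊤).mpr rfl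
  · exact (G.isUnrVerticial_iff_eq_top_of_vertGp_eq_top hV v₀ ⊤).mpr rfl
  · rw [unrTransport_top_eq, ← (H.isUnrVerticial_iff_eq_top_of_vertGp_eq_top hW w₀ B').mp hB']
  · rw [G.vertFil_eq_self_of_isOpen hV v₀ hU,
      H.vertFil_eq_self_of_isOpen hW w₀ (G.isOpen_coe_unrTransport H β hU)]

end Unr

end PSCDatum

end Literature.AnabelianGeometry.SemiGraphs

end
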